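import Summits.CriticalPhenomena.SAWScalingLimit.Theorems.SAWLeftRightFKGFKGToTraversalBoundSlitNecklacePieces
import HarnessLib

/-!
# Tight separated index windows
(crux `SAWLeftRightFKG.FKGToTraversalBound`, stmt-CriticalPhenomena-1878; line `slit-necklace`,
witness unit U7a of the registered witness stub `stub_necklaceWitnessFarU`)

`hasSepWindows_tighten` — `k` strictly separated index windows of a walk `p` across the shell
`D(y; σ₁, σ₂)` with `σ₁ < σ₂` (`HasSepWindows emb p k lo hi y σ₁ σ₂`) can be TIGHTENED: inside each
window `[a m, b m]` one finds a sub-window `a m ≤ a' m < b' m ≤ b m` with end vertices still on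
opposite sides of the shell (same orientation) and every vertex strictly between the two ends embedded
strictly inside the open band `σ₁ < dist · y < σ₂` (take the LAST index of the window on the starting
side, then the FIRST later index on the arriving side).  Count, range and strict separation are kept.

Pure index bookkeeping (`Nat.findGreatest` / `Nat.find`); no literature fact.
-/

noncomputable section

open Set
open Literature.Probability.LatticeModels

namespace Summit.CriticalPhenomena.SAWScalingLimit.Theorems.FKGToTraversalBound.SlitNecklace

/-- Discrete first-exit / last-entrance bookkeeping: if `P i`, `Q j`, `i ≤ j` and no index satisfies
both `P` and `Q`, then there are `i ≤ i' < j' ≤ j` with `P i'`, `Q j'` and neither `P` nor `Q` strictly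
between `i'` and `j'` (`i'` = the last index `≤ j` with `P`, `j'` = the first index after `i'` with `Q`).
[folklore] -/
private theorem exists_tight_subwindow {P Q : ℕ → Prop} (hPQ : ∀ n, P n → Q n → False) {i j : ℕ}
    (hij : i ≤ j) (hi : P i) (hj : Q j) :
    ∃ i' j', i ≤ i' ∧ i' < j' ∧ j' ≤ j ∧ P i' ∧ Q j' ∧ ∀ n, i' < n → n < j' → ¬P n ∧ ¬Q n := by
  classical
  have hPi' : P (Nat.findGreatest P j) := Nat.findGreatest_spec hij hi
  have hi'j : Nat.findGreatest P j ≤ j := Nat.findGreatest_le j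
  have hi'ltj : Nat.findGreatest P j < j :=
    lt_of_le_of_ne hi'j fun h => hPQ j (h ▸ hPi') hj
  have hex : ∃ n, Nat.findGreatest P j < n ∧ Q n := ⟨j, hi'ltj, hj⟩
  have hfind_le : Nat.find hex ≤ j := Nat.find_min' hex ⟨hi'ltj, hj⟩
  refine ⟨Nat.findGreatest P j, Nat.find hex, Nat.le_findGreatest hij hi, (Nat.find_spec hex).1,
    hfind_le, hPi', (Nat.find_spec hex).2, fun n h1 h2 => ⟨?_, fun hQ => ?_⟩⟩
  · exact Nat.findGreatest_is_greatest h1 (h2.le.trans hfind_le)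
  · exact Nat.find_min hex h2 ⟨h1, hQ⟩

/-- **Tight separated windows (witness unit U7a).**  From `k` strictly separated index windows of `p`
inside `[lo, hi]` across `D(y; σ₁, σ₂)`, `σ₁ < σ₂`, one gets `k` such windows `a m < b m` with, in
addition, every vertex strictly between the two ends of a window embedded strictly inside the open band:
`σ₁ < dist (emb (p.getVert n)) y < σ₂` for `a m < n < b m`. [folklore] -/
theorem hasSepWindows_tighten : ∀ {V E : Type*} [PseudoMetricSpace E] {G : SimpleGraph V} {u v : V}
    (emb : V → E) (p : G.Walk u v) (k lo hi : ℕ) (y : E) (σ₁ σ₂ : ℝ), σ₁ < σ₂ →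
    HasSepWindows emb p k lo hi y σ₁ σ₂ → ∃ a b : Fin k → ℕ, (∀ m, lo ≤ a m ∧ a m < b m ∧ b m ≤ hi) ∧
    (∀ m, (dist (emb (p.getVert (a m))) y ≤ σ₁ ∧ σ₂ ≤ dist (emb (p.getVert (b m))) y) ∨
      (σ₂ ≤ dist (emb (p.getVert (a m))) y ∧ dist (emb (p.getVert (b m))) y ≤ σ₁)) ∧
    (∀ ⦃m m' : Fin k⦄, m < m' → b m < a m') ∧ ∀ (m : Fin k) (n : ℕ), a m < n → n < b m →
      σ₁ < dist (emb (p.getVert n)) y ∧ dist (emb (p.getVert n)) y < σ₂ := by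
  intro V E _ G u v emb p k lo hi y σ₁ σ₂ hσ h
  obtain ⟨a, b, hab, hside, hsep⟩ := h
  -- no vertex is on both sides of the shell
  have hdisj : ∀ n, dist (emb (p.getVert n)) y ≤ σ₁ → σ₂ ≤ dist (emb (p.getVert n)) y → False :=
    fun n h1 h2 => (not_le.2 (hσ.trans_le h2)) h1
  -- the tight sub-window of each window
  have tight_one : ∀ m : Fin k, ∃ a' b' : ℕ, a m ≤ a' ∧ a' < b' ∧ b' ≤ b m ∧
      ((dist (emb (p.getVert a')) y ≤ σ₁ ∧ σ₂ ≤ dist (emb (p.getVert b')) y) ∨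
        (σ₂ ≤ dist (emb (p.getVert a')) y ∧ dist (emb (p.getVert b')) y ≤ σ₁)) ∧
      ∀ n, a' < n → n < b' → σ₁ < dist (emb (p.getVert n)) y ∧ dist (emb (p.getVert n)) y < σ₂ := by
    intro m
    rcases hside m with ⟨h1, h2⟩ | ⟨h1, h2⟩
    · obtain ⟨a', b', haa', ha'b', hb'b, hPa', hQb', hint⟩ :=
        exists_tight_subwindow (P := fun n => dist (emb (p.getVert n)) y ≤ σ₁)
          (Q := fun n => σ₂ ≤ dist (emb (p.getVert n)) y) hdisj (hab m).2.1 h1 h2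
      refine ⟨a', b', haa', ha'b', hb'b, Or.inl ⟨hPa', hQb'⟩, fun n hn1 hn2 => ?_⟩
      obtain ⟨hP, hQ⟩ := hint n hn1 hn2
      exact ⟨not_le.1 hP, not_le.1 hQ⟩
    · obtain ⟨a', b', haa', ha'b', hb'b, hPa', hQb', hint⟩ :=
        exists_tight_subwindow (P := fun n => σ₂ ≤ dist (emb (p.getVert n)) y)
          (Q := fun n => dist (emb (p.getVert n)) y ≤ σ₁) (fun n h1 h2 => hdisj n h2 h1)
          (hab m).2.1 h1 h2
      refine ⟨a', b', haa', ha'b', hb'b, Or.inr ⟨hPa', hQb'⟩, fun n hn1 hn2 => ?_⟩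
      obtain ⟨hP, hQ⟩ := hint n hn1 hn2
      exact ⟨not_le.1 hQ, not_le.1 hP⟩
  choose a' b' haa' ha'b' hb'b hside' hint using tight_one
  exact ⟨a', b', fun m => ⟨(hab m).1.trans (haa' m), ha'b' m, (hb'b m).trans (hab m).2.2⟩, hside',
    fun m m' hmm' => (hb'b m).trans_lt ((hsep hmm').trans_le (haa' m')), hint⟩

end Summit.CriticalPhenomena.SAWScalingLimit.Theorems.FKGToTraversalBound.SlitNecklace

end
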